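import Literature.Computability.Complexity.ExtMonotoneGRankSupport
import Literature.Computability.Complexity.CircuitComposition
import Literature.Computability.AlgebraicComplexity.ValiantCriterion
import Literature.Computability.AlgebraicComplexity.DeterminantalComplexity
import Literature.Computability.AlgebraicComplexity.DeterminantalConormalBoundKernelAlgebra
import Summits.PneNP.PneNP.Theorems.ConvexRankGatesBpmIsOneRankGate
import HarnessLib

/-!
# Crux `Capture` (stmt-PneNP-2659) — the SUPPORT SHADOW: a determinantal representation of the
# generating function `circuitSum Q` of a monotone Boolean function is ONE GRANK gate computing it

Part 1 of the kernel-checked VALIANT BARRIER of the crux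
`Summit.PneNP.PneNP.Theses.ConvexRankGates.Capture` (route PneNP/ConvexRankGates; idea card
`Cruxes/Capture/Ideas/permanent-shadow-bridge.md`, ideator 4, §2 `GFShadowOneGate`; lead c6, 2026-08-17).

For a `B₂`-circuit `Q` on `n` inputs, Valiant's criterion object
`ValiantCriterion.circuitSum Q = ∑_{e ∈ {0,1}ⁿ} [Q e] · ∏_{t : e_t = 1} X_t ∈ F[X₁,…,Xₙ]` is the generating
function of the true points of the function computed by `Q`. Its monomials are the `X^{𝟙_e}` with `Q e = 1`
(`coeff_ind_circuitSum`, `mem_support_circuitSum_iff`), so killing the variables outside `v` leaves exactly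
the true points `e ≤ v`, and for a MONOTONE function `f` computed by `Q`

  `killVars v (circuitSum Q) ≠ 0 ↔ f v = 1`                                (`killVars_circuitSum_ne_zero_iff`).

If moreover `circuitSum Q = det A` for a `d × d` matrix `A` of affine linear forms (`HasDetRepr (circuitSum Q) d`,
Bürgisser 2000 §2.5), write `A = K₀ + ∑ᵢ Xᵢ Kᵢ` (`symbolicPolyMatrix_coeffs_eq`); a square matrix over a field
has full rank iff its determinant is non-zero (`le_rank_iff_det_ne_zero_of_sq`, BpmIsOneRankGate) and minors commute with killing
variables (`det_submatrix_symbolicMatrix_eq_zero_iff`), so the generic-rank threshold gate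
`v ↦ [d ≤ rank_{Frac F[X]} (K₀ + ∑_{vᵢ = 1} Xᵢ Kᵢ)]` computes `f`:

  `isGRankGate_of_hasDetRepr_circuitSum : Q.Computes f → Monotone f → HasDetRepr (circuitSum Q) d → IsGRankGate d ⟨n, f⟩`.

This is the "one wide gate per function" half of the bridge `[∃ F, dc_F(HC_m) polynomially bounded] ⇒ Capture`
(assembly in `ConvexRankGatesCaptureValiantBarrier.lean`). No new definitions. [folklore]
-/

namespace Summit.PneNP.PneNP.Theorems.Capture.ValiantBarrier

set_option linter.dupNamespace false -- `Summit.PneNP.PneNP.…`: summit = sub-problem (D-0017)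

open Literature.Computability.Complexity Literature.Computability.AlgebraicComplexity MvPolynomial
open Literature.Computability.AlgebraicComplexity.ValiantCriterion (circuitSum)
open Literature.Computability.AlgebraicComplexity.CircuitArith (toK)

/-! ## Monomials and support of `circuitSum Q` -/

section Support

variable {n : ℕ}

/-- `e ↦ 𝟙_e` (the exponent vector `[e_t]`) is injective. [folklore] -/
theorem indFinsupp_injective :
    Function.Injective (fun e : Fin n → Bool =>
      Finsupp.equivFunOnFinite.symm (fun t => if e t = true then (1 : ℕ) else 0)) := by
  intro e e' h
  funext t
  have := congrArg (fun s => s t) h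
  simp only [Finsupp.coe_equivFunOnFinite_symm] at this
  cases he : e t <;> cases he' : e' t <;> simp [he, he'] at this ⊢

/-- The support of `𝟙_e` is the set of coordinates switched on in `e`. [folklore] -/
theorem mem_support_indFinsupp_iff (e : Fin n → Bool) (t : Fin n) :
    t ∈ (Finsupp.equivFunOnFinite.symm (fun t => if e t = true then (1 : ℕ) else 0)).support ↔
      e t = true := by
  rw [Finsupp.mem_support_iff, Finsupp.coe_equivFunOnFinite_symm]
  cases e t <;> simp

variable (F : Type*) [CommRing F]

/-- The selector product `∏_{t : e_t = 1} X_t` is the monomial `X^{𝟙_e}`. [folklore] -/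
theorem prod_ite_X_eq_monomial (e : Fin n → Bool) :
    (∏ t : Fin n, (if e t = true then X t else 1) : MvPolynomial (Fin n) F) =
      monomial (Finsupp.equivFunOnFinite.symm (fun t => if e t = true then (1 : ℕ) else 0)) 1 := by
  rw [monomial_eq, C_1, one_mul, Finsupp.prod_fintype _ _ (fun i => pow_zero _)]
  refine Finset.prod_congr rfl fun t _ => ?_
  rw [Finsupp.coe_equivFunOnFinite_symm]
  split_ifs <;> simp

/-- `circuitSum Q = ∑_e monomial 𝟙_e [Q e]`. [folklore] -/
theorem circuitSum_eq_sum_monomial (Q : Circuit (Fin n)) :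
    circuitSum (k := F) Q = ∑ e : Fin n → Bool,
      monomial (Finsupp.equivFunOnFinite.symm (fun t => if e t = true then (1 : ℕ) else 0))
        (toK F (Q.eval e)) := by
  unfold circuitSum
  refine Finset.sum_congr rfl fun e _ => ?_
  rw [prod_ite_X_eq_monomial, C_mul_monomial, mul_one]

/-- Coefficients of Valiant's criterion object: `[X^{𝟙_e}] circuitSum Q = [Q e]`. [folklore] -/
theorem coeff_ind_circuitSum (Q : Circuit (Fin n)) (e : Fin n → Bool) :
    coeff (Finsupp.equivFunOnFinite.symm (fun t => if e t = true then (1 : ℕ) else 0))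
      (circuitSum (k := F) Q) = toK F (Q.eval e) := by
  classical
  rw [circuitSum_eq_sum_monomial, coeff_sum, Finset.sum_eq_single e]
  · rw [coeff_monomial, if_pos rfl]
  · intro e' _ hne
    rw [coeff_monomial, if_neg (fun h => hne (indFinsupp_injective h))]
  · intro h; exact absurd (Finset.mem_univ e) h

/-- Exponent vectors not of the form `𝟙_e` do not occur in `circuitSum Q`. [folklore] -/
theorem coeff_circuitSum_eq_zero (Q : Circuit (Fin n)) (s : Fin n →₀ ℕ)
    (hs : ∀ e : Fin n → Bool,
      s ≠ Finsupp.equivFunOnFinite.symm (fun t => if e t = true then (1 : ℕ) else 0)) :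
    coeff s (circuitSum (k := F) Q) = 0 := by
  classical
  rw [circuitSum_eq_sum_monomial, coeff_sum]
  refine Finset.sum_eq_zero fun e _ => ?_
  rw [coeff_monomial, if_neg (fun h => hs e h.symm)]

/-- **Support of `circuitSum Q`** (over a non-trivial coefficient ring): the exponent vectors occurring
are exactly the `𝟙_e` of the accepted points `e`. [folklore] -/
theorem mem_support_circuitSum_iff [Nontrivial F] (Q : Circuit (Fin n)) (s : Fin n →₀ ℕ) :
    s ∈ (circuitSum (k := F) Q).support ↔ ∃ e : Fin n → Bool, Q.eval e = true ∧
      s = Finsupp.equivFunOnFinite.symm (fun t => if e t = true then (1 : ℕ) else 0) := by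
  rw [mem_support_iff]
  constructor
  · intro h
    by_contra hne
    push Not at hne
    by_cases hs : ∃ e : Fin n → Bool,
        s = Finsupp.equivFunOnFinite.symm (fun t => if e t = true then (1 : ℕ) else 0)
    · obtain ⟨e, rfl⟩ := hs
      rw [coeff_ind_circuitSum] at h
      have hfe : Q.eval e = false := by
        cases hq : Q.eval e
        · rfl
        · exact absurd rfl (hne e hq)
      rw [hfe] at h
      exact h rfl
    · push Not at hs
      exact h (coeff_circuitSum_eq_zero F Q s hs)
  · rintro ⟨e, hfe, rfl⟩
    rw [coeff_ind_circuitSum, hfe]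
    exact one_ne_zero

end Support

/-! ## Killing the unselected variables: the support shadow of `circuitSum Q` is the computed function -/

section Shadow

variable {F : Type*} [Field F] {n : ℕ}

/-- **Support shadow.** If `Q` computes the MONOTONE function `f`, killing the variables outside `v` leaves
`circuitSum Q` non-zero iff `f v = 1`: the surviving monomials are the `X^{𝟙_e}` with `f e = 1`, `e ≤ v`. [folklore] -/
theorem killVars_circuitSum_ne_zero_iff {Q : Circuit (Fin n)} {f : (Fin n → Bool) → Bool}
    (hQ : Q.Computes f) (hf : Monotone f) (v : Fin n → Bool) :
    killVars v (circuitSum (k := F) Q) ≠ 0 ↔ f v = true := by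
  rw [killVars_ne_zero_iff]
  constructor
  · rintro ⟨s, hs, hv⟩
    obtain ⟨e, hfe, rfl⟩ := (mem_support_circuitSum_iff F Q s).1 hs
    rw [hQ e] at hfe
    have hev : e ≤ v := by
      intro t
      cases het : e t
      · exact Bool.false_le _
      · exact (hv t ((mem_support_indFinsupp_iff e t).2 het)).ge
    exact eq_true_of_le_of_eq_true (hf hev) hfe
  · intro hfv
    refine ⟨_, (mem_support_circuitSum_iff F Q _).2 ⟨v, (hQ v).trans hfv, rfl⟩, fun t ht => ?_⟩
    exact (mem_support_indFinsupp_iff v t).1 ht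

/-- The affine matrix `A` (entries of total degree `≤ 1`) IS the generic symbolic matrix `K₀ + ∑ᵢ Xᵢ Kᵢ` of its
constant and linear coefficient matrices. [folklore] -/
theorem symbolicPolyMatrix_coeffs_eq {d : ℕ} (A : Matrix (Fin d) (Fin d) (MvPolynomial (Fin n) F))
    (hA : ∀ a b, (A a b).totalDegree ≤ 1) :
    symbolicPolyMatrix (fun a b => coeff 0 (A a b))
      (fun i => fun a b => coeff (Finsupp.single i 1) (A a b)) = A := by
  refine Matrix.ext fun a b => ?_
  conv_rhs => rw [DeterminantalConormal.eq_C_add_sum_of_totalDegree_le_one (hA a b)]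
  simp only [symbolicPolyMatrix, Matrix.add_apply, Matrix.map_apply, Matrix.sum_apply,
    Matrix.smul_apply, smul_eq_mul]
  congr 1
  exact Finset.sum_congr rfl fun i _ => mul_comm _ _

/-- **The support shadow is one GRANK gate** (card permanent-shadow-bridge §2 `GFShadowOneGate`): if the
`B₂`-circuit `Q` computes the monotone `f : {0,1}ⁿ → {0,1}` and `circuitSum Q` has an affine determinantal
representation of size `d` over a field `F`, then `f` is a generic-rank threshold gate of dimension `d`:
`f v = 1 ↔ d ≤ rank_{Frac F[X]} (K₀ + ∑_{vᵢ=1} Xᵢ Kᵢ)` where `A = K₀ + ∑ Xᵢ Kᵢ`, `det A = circuitSum Q`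
(full rank ↔ `det ≠ 0`; `det` of the specialisation is the specialisation `killVars v (det A)`; support shadow
`killVars_circuitSum_ne_zero_iff`). [folklore] -/
theorem isGRankGate_of_hasDetRepr_circuitSum : ∀ {F : Type} [Field F] {n d : ℕ} {Q : Circuit (Fin n)}
    {f : (Fin n → Bool) → Bool}, Q.Computes f → Monotone f →
    HasDetRepr (ValiantCriterion.circuitSum (k := F) Q) d → IsGRankGate d ⟨n, f⟩ := by
  intro F _ n d Q f hQ hf h
  obtain ⟨A, hA1, hAdet⟩ := h
  refine ⟨F, inferInstance, d, d, le_rfl, fun a b => coeff 0 (A a b),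
    fun i => fun a b => coeff (Finsupp.single i 1) (A a b), fun v => ?_⟩
  change f v = true ↔ _
  rw [le_rank_iff_det_ne_zero_of_sq, Ne, ← Matrix.submatrix_id_id (symbolicMatrix _ _ v),
    det_submatrix_symbolicMatrix_eq_zero_iff, Matrix.submatrix_id_id, symbolicPolyMatrix_coeffs_eq A hA1,
    hAdet, ← Ne, killVars_circuitSum_ne_zero_iff hQ hf]

/-- Circuit form: under the same hypotheses `f` has a size-ONE circuit whose only gate is a GRANK gate of
dimension `d`. [folklore] -/
theorem exists_circuit_grank_of_hasDetRepr_circuitSum {F : Type} [Field F] {n d : ℕ} {Q : Circuit (Fin n)}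
    {f : (Fin n → Bool) → Bool} (hQ : Q.Computes f) (hf : Monotone f)
    (h : HasDetRepr (circuitSum (k := F) Q) d) :
    ∃ C : Circuit (Fin n), C.IsOver {g | IsGRankGate d g} ∧ C.size ≤ 1 ∧ C.Computes f := by
  obtain ⟨C, hB, hs, hC⟩ := (CktSize.gate (B := {g | IsGRankGate d g}) ⟨n, f⟩
    (isGRankGate_of_hasDetRepr_circuitSum hQ hf h) id).toCircuit
  exact ⟨C, hB, hs, fun x => hC x⟩

end Shadow

end Summit.PneNP.PneNP.Theorems.Capture.ValiantBarrier
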